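import Mathlib
import Summits.NavierStokesRegularity.NavierStokesRegularity.Theorems.FilamentSkeletonRssStadiumRightWingFrozenAny
import Summits.NavierStokesRegularity.NavierStokesRegularity.Theorems.FilamentSkeletonRssStadiumCornerTransport

/-!
# Route `FilamentSkeletonRss` · cruxes `SkeletonJ1L` (stmt-NavierStokesRegularity-23296, registered stub `stub_tangentSkeletonL` ≡
# `TangentSkeletonNearStraightL`, stmt-23320) · line `child_tangent_analytic_strip_L` (b0b56c52900dd90a), stub `stub_stripPropagation` —
# brick for `rcore`: THE FROZEN RIGHT WING FOR EVERY ANCHOR OF THE QUARTER STADIUM (re-centring removes `cc ≤ x₀`)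

The corner certificates carry `cc ≤ x₀ < cc + L + hs/4`; `Theorems.StadiumCornerTransport.restrict_package` / `centre_at_target` re-centre the
stadium at the anchor abscissa (`cc' = x₀`, `L' = L − |x₀ − cc|`), where `cc' ≤ x₀` is trivial, and the right wing of the anchor lies in the
re-centred stadium.  Since the conclusions of `Theorems.StadiumRightWingFrozenAny` do not mention the centre, they transport to EVERY anchor with
`|Im z₀| < hs/4`, `|Re z₀ − cc| < L + hs/4`:
* `right_wing_pos_general` — plateau and descent positivity in segment form;
* `right_wing_frozen_general` — the frozen right wing is holomorphic and bounded on a ball `B(z₀, δ) ⊆ S`;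
* `right_wing_tubes_general` — one source-tube radius (tubes inside the principal-branch set of the ORIGINAL stadium).
HONEST FRAMING: bookkeeping for a HYPOTHETICAL filament skeleton on the NEGATIVE side of a MODEL route; the stub `stub_stripPropagation` is NOT closed
by this file, `TangentSkeletonNearStraightL` / `SkeletonJ1L` stay OPEN; nothing here bears on Navier–Stokes regularity or blow-up.
`--supports stmt-NavierStokesRegularity-23320` (≡ stub `stub_tangentSkeletonL` of 23296).
-/

set_option linter.dupNamespace false

noncomputable section

namespace Summit.NavierStokesRegularity.NavierStokesRegularity.Theorems.StadiumRightWingGeneral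

open Set Filter Topology Complex MeasureTheory Metric Finset
open scoped InnerProductSpace Matrix
open Summit.NavierStokesRegularity.NavierStokesRegularity.Theorems.StadiumRightWingPos
open Summit.NavierStokesRegularity.NavierStokesRegularity.Theorems.StadiumRightWingFrozenAny
open Summit.NavierStokesRegularity.NavierStokesRegularity.Theorems.StadiumCornerTransport

/-- **Right-wing positivity for every anchor of the quarter stadium** (re-centred certificates). [folklore] -/
theorem right_wing_pos_general {hs L cc : ℝ} {F : ℂ → (Fin 3 → ℂ)}
    (hF : DifferentiableOn ℂ F {z : ℂ | |z.im| < hs ∧ |z.re - cc| < L + hs})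
    (hM : ∀ z ∈ {z : ℂ | |z.im| < hs ∧ |z.re - cc| < L + hs}, ‖deriv F z‖ ≤ 2)
    (hunit : ∀ w ∈ {z : ℂ | |z.im| < hs ∧ |z.re - cc| < L + hs}, ∑ i, (deriv F w i) ^ 2 = 1)
    {X : ℝ → EuclideanSpace ℝ (Fin 3)} (hX : ContDiff ℝ 1 X) (hXu : ∀ τ, ‖deriv X τ‖ = 1)
    {Rb : ℝ} (hRb0 : 0 ≤ Rb) (hRb : Rb ≤ 1 / 2) (hosc : ∀ τ σ, ‖deriv X τ - deriv X σ‖ ≤ Rb)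
    (hFX : ∀ r : ℝ, (r : ℂ) ∈ {z : ℂ | |z.im| < hs ∧ |z.re - cc| < L + hs} →
      F r = fun i => ((⟪X r, EuclideanSpace.single i (1:ℝ)⟫_ℝ : ℝ) : ℂ))
    (hhs : 0 < hs) {x₀ Y₀ : ℝ} (hY : |Y₀| < hs / 4) (hx₀ : |x₀ - cc| < L + hs / 4)
    {G : ℂ → ℂ} {κ g₀ : ℝ} (hκ : 0 < κ) (hg₀ : 0 < g₀)
    (hG : ∀ w ∈ {z : ℂ | |z.im| < hs ∧ |z.re - cc| < L + hs}, g₀ ≤ (G w).re) :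
    (∀ t ∈ Icc (0:ℝ) 1,
      0 < ((∑ i, (F ((x₀ : ℂ) + (Y₀ : ℂ) * Complex.I) i -
          F (((x₀ : ℂ) + (Y₀ : ℂ) * Complex.I) + (t : ℂ) *
            ((((x₀ : ℂ) + (Y₀ : ℂ) * Complex.I) + ((hs / 5 : ℝ) : ℂ)) - ((x₀ : ℂ) + (Y₀ : ℂ) * Complex.I))) i) ^ 2) +
        (κ : ℂ) * G (((x₀ : ℂ) + (Y₀ : ℂ) * Complex.I) + (t : ℂ) *
            ((((x₀ : ℂ) + (Y₀ : ℂ) * Complex.I) + ((hs / 5 : ℝ) : ℂ)) - ((x₀ : ℂ) + (Y₀ : ℂ) * Complex.I)))).re) ∧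
    (∀ t ∈ Icc (0:ℝ) 1,
      0 < ((∑ i, (F ((x₀ : ℂ) + (Y₀ : ℂ) * Complex.I) i -
          F ((((x₀ + hs / 5 : ℝ) : ℂ) + (Y₀ : ℂ) * Complex.I) + (t : ℂ) *
            (((x₀ + hs / 2 : ℝ) : ℂ) - (((x₀ + hs / 5 : ℝ) : ℂ) + (Y₀ : ℂ) * Complex.I))) i) ^ 2) +
        (κ : ℂ) * G ((((x₀ + hs / 5 : ℝ) : ℂ) + (Y₀ : ℂ) * Complex.I) + (t : ℂ) *
            (((x₀ + hs / 2 : ℝ) : ℂ) - (((x₀ + hs / 5 : ℝ) : ℂ) + (Y₀ : ℂ) * Complex.I)))).re) := by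
  obtain ⟨hlo, hhi, hcc, hlt⟩ := centre_at_target (hs := hs) (L := L) (cc := cc) hx₀
  obtain ⟨hF', hM', hunit', hFX'⟩ := restrict_package hF hM hunit hFX hlo hhi
  have hsub : {z : ℂ | |z.im| < hs ∧ |z.re - x₀| < (L - |x₀ - cc|) + hs} ⊆ {z : ℂ | |z.im| < hs ∧ |z.re - cc| < L + hs} := by
    intro z hz
    refine ⟨hz.1, ?_⟩
    calc |z.re - cc| ≤ |z.re - x₀| + |x₀ - cc| := abs_sub_le _ _ _
      _ < L + hs := by linarith [hz.2]
  have hG' : ∀ w ∈ {z : ℂ | |z.im| < hs ∧ |z.re - x₀| < (L - |x₀ - cc|) + hs}, g₀ ≤ (G w).re := fun w hw => hG w (hsub hw)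
  exact ⟨right_plateau_pos hF' hM' hunit' hhs hY hlt hcc hκ hg₀ hG',
    right_descent_pos_any hF' hM' hunit' hX hXu hRb0 hRb hosc hFX' hhs hY hlt hcc hκ hg₀ hG'⟩

/-- **The frozen right wing of EVERY anchor of the quarter stadium is holomorphic and bounded near the anchor** (re-centred
`Theorems.StadiumRightWingFrozenAny.right_wing_frozen_any`). [folklore] -/
theorem right_wing_frozen_general {hs L cc : ℝ} {F : ℂ → (Fin 3 → ℂ)}
    (hF : DifferentiableOn ℂ F {z : ℂ | |z.im| < hs ∧ |z.re - cc| < L + hs})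
    (hM : ∀ z ∈ {z : ℂ | |z.im| < hs ∧ |z.re - cc| < L + hs}, ‖deriv F z‖ ≤ 2)
    (hunit : ∀ w ∈ {z : ℂ | |z.im| < hs ∧ |z.re - cc| < L + hs}, ∑ i, (deriv F w i) ^ 2 = 1)
    {X : ℝ → EuclideanSpace ℝ (Fin 3)} (hX : ContDiff ℝ 1 X) (hXu : ∀ τ, ‖deriv X τ‖ = 1)
    {Rb : ℝ} (hRb0 : 0 ≤ Rb) (hRb : Rb ≤ 1 / 2) (hosc : ∀ τ σ, ‖deriv X τ - deriv X σ‖ ≤ Rb)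
    (hFX : ∀ r : ℝ, (r : ℂ) ∈ {z : ℂ | |z.im| < hs ∧ |z.re - cc| < L + hs} →
      F r = fun i => ((⟪X r, EuclideanSpace.single i (1:ℝ)⟫_ℝ : ℝ) : ℂ))
    {G : ℂ → ℂ} (hG : ContinuousOn G {z : ℂ | |z.im| < hs ∧ |z.re - cc| < L + hs})
    {κ g₀ : ℝ} (hκ : 0 < κ) (hg₀ : 0 < g₀) (hGre : ∀ w ∈ {z : ℂ | |z.im| < hs ∧ |z.re - cc| < L + hs}, g₀ ≤ (G w).re)
    (hhs : 0 < hs) {x₀ Y₀ : ℝ} (hY : |Y₀| < hs / 4) (hx₀ : |x₀ - cc| < L + hs / 4) :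
    let P : ℕ → ℂ := fun k => if k = 0 then (x₀ : ℂ) + (Y₀ : ℂ) * Complex.I
      else if k = 1 then ((x₀ : ℂ) + (Y₀ : ℂ) * Complex.I) + ((hs / 5 : ℝ) : ℂ) else ((x₀ + hs / 2 : ℝ) : ℂ)
    ∃ δ C : ℝ, 0 < δ ∧ ball ((x₀ : ℂ) + (Y₀ : ℂ) * Complex.I) δ ⊆ {z : ℂ | |z.im| < hs ∧ |z.re - cc| < L + hs} ∧
      DifferentiableOn ℂ (fun z => ∑ k ∈ range 2, ∫ t in (0:ℝ)..1, (P (k+1) - P k) •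
        ((((∑ i, (F z i - F (P k + (t : ℂ) * (P (k+1) - P k)) i) ^ 2) +
            (κ : ℂ) * G (P k + (t : ℂ) * (P (k+1) - P k))) ^ ((3:ℂ) / 2))⁻¹ •
          (deriv F (P k + (t : ℂ) * (P (k+1) - P k)) ⨯₃
            (fun i => F z i - F (P k + (t : ℂ) * (P (k+1) - P k)) i))))
        (ball ((x₀ : ℂ) + (Y₀ : ℂ) * Complex.I) δ) ∧
      ∀ z ∈ ball ((x₀ : ℂ) + (Y₀ : ℂ) * Complex.I) δ, ‖∑ k ∈ range 2, ∫ t in (0:ℝ)..1, (P (k+1) - P k) •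
        ((((∑ i, (F z i - F (P k + (t : ℂ) * (P (k+1) - P k)) i) ^ 2) +
            (κ : ℂ) * G (P k + (t : ℂ) * (P (k+1) - P k))) ^ ((3:ℂ) / 2))⁻¹ •
          (deriv F (P k + (t : ℂ) * (P (k+1) - P k)) ⨯₃
            (fun i => F z i - F (P k + (t : ℂ) * (P (k+1) - P k)) i)))‖ ≤ C := by
  intro P
  obtain ⟨hlo, hhi, hcc, hlt⟩ := centre_at_target (hs := hs) (L := L) (cc := cc) hx₀
  obtain ⟨hF', hM', hunit', hFX'⟩ := restrict_package hF hM hunit hFX hlo hhi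
  have hsub : {z : ℂ | |z.im| < hs ∧ |z.re - x₀| < (L - |x₀ - cc|) + hs} ⊆ {z : ℂ | |z.im| < hs ∧ |z.re - cc| < L + hs} := by
    intro z hz
    refine ⟨hz.1, ?_⟩
    calc |z.re - cc| ≤ |z.re - x₀| + |x₀ - cc| := abs_sub_le _ _ _
      _ < L + hs := by linarith [hz.2]
  have hG' : ContinuousOn G {z : ℂ | |z.im| < hs ∧ |z.re - x₀| < (L - |x₀ - cc|) + hs} := hG.mono hsub
  have hGre' : ∀ w ∈ {z : ℂ | |z.im| < hs ∧ |z.re - x₀| < (L - |x₀ - cc|) + hs}, g₀ ≤ (G w).re := fun w hw => hGre w (hsub hw)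
  obtain ⟨δ, C, hδ, hball, hdiff, hbd⟩ :=
    right_wing_frozen_any hF' hM' hunit' hX hXu hRb0 hRb hosc hFX' hG' hκ hg₀ hGre' hhs hY hlt hcc
  exact ⟨δ, C, hδ, hball.trans hsub, hdiff, hbd⟩

/-- **One source-tube radius for the right wing of EVERY anchor of the quarter stadium** (re-centred
`Theorems.StadiumRightWingFrozenAny.right_wing_tubes_any`; tubes land in the principal-branch set of the original stadium). [folklore] -/
theorem right_wing_tubes_general {hs L cc : ℝ} {F : ℂ → (Fin 3 → ℂ)}
    (hF : DifferentiableOn ℂ F {z : ℂ | |z.im| < hs ∧ |z.re - cc| < L + hs})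
    (hM : ∀ z ∈ {z : ℂ | |z.im| < hs ∧ |z.re - cc| < L + hs}, ‖deriv F z‖ ≤ 2)
    (hunit : ∀ w ∈ {z : ℂ | |z.im| < hs ∧ |z.re - cc| < L + hs}, ∑ i, (deriv F w i) ^ 2 = 1)
    {X : ℝ → EuclideanSpace ℝ (Fin 3)} (hX : ContDiff ℝ 1 X) (hXu : ∀ τ, ‖deriv X τ‖ = 1)
    {Rb : ℝ} (hRb0 : 0 ≤ Rb) (hRb : Rb ≤ 1 / 2) (hosc : ∀ τ σ, ‖deriv X τ - deriv X σ‖ ≤ Rb)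
    (hFX : ∀ r : ℝ, (r : ℂ) ∈ {z : ℂ | |z.im| < hs ∧ |z.re - cc| < L + hs} →
      F r = fun i => ((⟪X r, EuclideanSpace.single i (1:ℝ)⟫_ℝ : ℝ) : ℂ))
    {G : ℂ → ℂ} (hG : DifferentiableOn ℂ G {z : ℂ | |z.im| < hs ∧ |z.re - cc| < L + hs})
    {κ g₀ : ℝ} (hκ : 0 < κ) (hg₀ : 0 < g₀) (hGre : ∀ w ∈ {z : ℂ | |z.im| < hs ∧ |z.re - cc| < L + hs}, g₀ ≤ (G w).re)
    (hhs : 0 < hs) {x₀ Y₀ : ℝ} (hY : |Y₀| < hs / 4) (hx₀ : |x₀ - cc| < L + hs / 4) :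
    let P : ℕ → ℂ := fun k => if k = 0 then (x₀ : ℂ) + (Y₀ : ℂ) * Complex.I
      else if k = 1 then ((x₀ : ℂ) + (Y₀ : ℂ) * Complex.I) + ((hs / 5 : ℝ) : ℂ) else ((x₀ + hs / 2 : ℝ) : ℂ)
    ∃ δ : ℝ, 0 < δ ∧ ball ((x₀ : ℂ) + (Y₀ : ℂ) * Complex.I) δ ⊆ {z : ℂ | |z.im| < hs ∧ |z.re - cc| < L + hs} ∧
      ∀ z ∈ ball ((x₀ : ℂ) + (Y₀ : ℂ) * Complex.I) δ, ∀ k < 2, ∀ t ∈ Icc (0:ℝ) 1,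
        ball (P k + (t : ℂ) * (P (k+1) - P k)) δ ⊆
          {ζ : ℂ | ζ ∈ {z : ℂ | |z.im| < hs ∧ |z.re - cc| < L + hs} ∧
            0 < ((∑ i, (F z i - F ζ i) ^ 2) + (κ : ℂ) * G ζ).re} := by
  intro P
  obtain ⟨hlo, hhi, hcc, hlt⟩ := centre_at_target (hs := hs) (L := L) (cc := cc) hx₀
  obtain ⟨hF', hM', hunit', hFX'⟩ := restrict_package hF hM hunit hFX hlo hhi
  have hsub : {z : ℂ | |z.im| < hs ∧ |z.re - x₀| < (L - |x₀ - cc|) + hs} ⊆ {z : ℂ | |z.im| < hs ∧ |z.re - cc| < L + hs} := by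
    intro z hz
    refine ⟨hz.1, ?_⟩
    calc |z.re - cc| ≤ |z.re - x₀| + |x₀ - cc| := abs_sub_le _ _ _
      _ < L + hs := by linarith [hz.2]
  have hG' : DifferentiableOn ℂ G {z : ℂ | |z.im| < hs ∧ |z.re - x₀| < (L - |x₀ - cc|) + hs} := hG.mono hsub
  have hGre' : ∀ w ∈ {z : ℂ | |z.im| < hs ∧ |z.re - x₀| < (L - |x₀ - cc|) + hs}, g₀ ≤ (G w).re := fun w hw => hGre w (hsub hw)
  obtain ⟨δ, hδ, hball, htube⟩ :=
    right_wing_tubes_any hF' hM' hunit' hX hXu hRb0 hRb hosc hFX' hG' hκ hg₀ hGre' hhs hY hlt hcc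
  refine ⟨δ, hδ, hball.trans hsub, fun z hz k hk t ht => (htube z hz k hk t ht).trans ?_⟩
  intro ζ hζ
  exact ⟨hsub hζ.1, hζ.2⟩

end Summit.NavierStokesRegularity.NavierStokesRegularity.Theorems.StadiumRightWingGeneral

end
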